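import Literature.Geometry.Lorentzian.SchoenYauHeightBound
import HarnessLib

/-!
# Schoen–Yau 1979, (2.4): `|y|²` is convex far out on an end; no interior maximum of `|x|²`
on a minimal surface far out

Schoen–Yau, Comm. Math. Phys. 65 (1979), §2 Step 2, p. 50: on an end with asymptotically flat
coordinates `y` and metric `g'ᵢⱼ` satisfying (1.1), *"we calculate the covariant hessian of the
function `|y|²` … By (1.1) we see `D_{ij}|y|² = 2δ_{ij} + O(1/|y|)` as `|y| → ∞`. In particular,
there exists `τ₁ > τ₀` so that the function `|y|²` is a convex function for `|y| ≥ τ₁`. … we may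
apply the maximum principle to conclude that `S_σ ∩ N_{k'} ⊆ B_{τ₁}(0)`"* — the confinement
(2.4) of the Plateau solutions away from the other ends. The same convexity ("convex hull
property" far out) is used again in the proof of the Claim `∫_S K ≤ 0` (pp. 56–58).

* `AFEnd.eventually_sq_le_hessAt_hCoeff_normSq` — **convexity of `|y|²` far out**, coordinate
  form: for `G = hCoeff e D` with `IsAsymptoticallySchwarzschild e D M 2`, eventually along
  `cobounded E3`, `Hess_G |y|² (X, X) ≥ ‖X‖²` for all `X` (`D²|y|² = 2δ`, and the Christoffel term
  `2⟨y, Γ(X,X)⟩` is `O(1/r)‖X‖²` since `‖DG‖ = O(r⁻²)`).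
* `SchoenYau.not_isLocalMax_normSq` — **(2.4), pointwise form**: there is `ρ₀` such that for every
  spacelike immersed surface `F : S → X` with smooth unit normal and mean curvature `H ≡ 0` and
  every `y₀` with `‖x(F y₀)‖ > ρ₀`, the function `y ↦ ‖x(F y)‖²` has no local maximum at `y₀`
  (`Δ_S(|x|² ∘ F) = tr_S Hess |x|²(dF·, dF·) > 0` by `dalembertian_comp_eq` with `H = 0`, against
  `Δ_S ≤ 0` at a local maximum, `dalembertian_nonpos_of_isLocalMax`).

Everything is proved; no named fact and no `sorry` is introduced.

## References

* R. Schoen, S.-T. Yau, *On the proof of the positive mass conjecture in general relativity*,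
  Comm. Math. Phys. 65 (1979), 45–76, §2 Step 2, (2.4) (p. 50). [SchoenYauPMT1979]
-/

noncomputable section

set_option maxSynthPendingDepth 3

open Bundle Set Function Filter Asymptotics Bornology Metric ContinuousLinearMap
open scoped Manifold ContDiff Topology RealInnerProductSpace

namespace Literature.Geometry.Lorentzian

open MetricCoord

namespace AFEnd

variable {X : Type} [TopologicalSpace X] [ChartedSpace E3 X] [IsManifold (𝓡 3) ∞ X]
  (e : AFEnd X) (D : InitialDataSet (𝓡 3) X)

set_option maxHeartbeats 800000 in
/-- **Schoen–Yau 1979, (2.4): `|y|²` is convex far out**, coordinate form. If the chart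
components `G = hCoeff e D` have the expansion (1.1) (`IsAsymptoticallySchwarzschild e D M 2`, any
sign of `M`), then eventually along `cobounded E3` the coordinate covariant Hessian of `|y|²`
satisfies `Hess_G |y|² (y)(X, X) ≥ ‖X‖²` for all `X` (printed: "`D_{ij}|y|² = 2δ_{ij} + O(1/|y|)`
… `|y|²` is a convex function for `|y| ≥ τ₁`"): `D²|y|²(X,X) = 2‖X‖²` and
`|D|y|²(Γ(X,X))| ≤ 2|y| · (3/2)‖♯‖‖DG‖‖X‖² ≤ 6(3|M| + C₁)|y|⁻¹‖X‖²`.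
[cite: SchoenYauPMT1979, §2 Step 2, (2.4) (p. 50)] -/
theorem eventually_sq_le_hessAt_hCoeff_normSq {M : ℝ}
    (hAS : IsAsymptoticallySchwarzschild e D M 2) :
    ∀ᶠ y in cobounded E3, ∀ X : E3,
      ‖X‖ ^ 2 ≤ hessAt (hCoeff e D) (fun z : E3 ↦ ‖z‖ ^ 2) y X X := by
  -- notation
  set δ : E3 →L[ℝ] E3 →L[ℝ] ℝ := (innerSL ℝ : E3 →L[ℝ] E3 →L[ℝ] ℝ) with hδdef
  have hδ : ∀ v w : E3, δ v w = ⟪v, w⟫ := fun v w ↦ rfl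
  set G : E3 → E3 →L[ℝ] E3 →L[ℝ] ℝ := hCoeff e D with hGdef
  set w : E3 → ℝ := fun y ↦ 1 + M / (2 * ‖y‖) with hwdef
  set G₀ : E3 → E3 →L[ℝ] E3 →L[ℝ] ℝ := fun y ↦ w y ^ 4 • δ with hG₀def
  -- (1.1): `G - G₀ = O(r⁻²)`, `∂(G - G₀) = O(r⁻³)`
  have hO0 := hAS 0 (by norm_num)
  have hO1 := hAS 1 (by norm_num)
  simp only [Nat.cast_zero, sub_zero, Nat.cast_one] at hO0 hO1
  have hO0' : (fun x ↦ ‖G x - G₀ x‖) =O[cobounded E3] fun x ↦ ‖x‖ ^ (-(2 : ℕ) : ℝ) := by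
    refine (hO0.congr_left fun x ↦ ?_).congr_right fun x ↦ by norm_num
    rw [norm_iteratedFDeriv_zero]
  have hO1' : (fun x ↦ ‖fderiv ℝ (fun y ↦ G y - G₀ y) x‖) =O[cobounded E3]
      fun x ↦ ‖x‖ ^ (-(3 : ℕ) : ℝ) := by
    refine (hO1.congr_left fun x ↦ ?_).congr_right fun x ↦ by norm_num
    rw [norm_iteratedFDeriv_one]
  obtain ⟨C₁, hC₁, hev1⟩ := exists_pos_eventually_le_of_isBigO (fun x ↦ norm_nonneg _) hO1'
  -- `G - G₀ → 0`
  have htend : Tendsto (fun x ↦ ‖G x - G₀ x‖) (cobounded E3) (𝓝 0) := by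
    refine hO0'.trans_tendsto ?_
    have h := (tendsto_rpow_neg_atTop (by norm_num : (0 : ℝ) < 2)).comp
      (tendsto_norm_cobounded_atTop (E := E3))
    refine h.congr fun x ↦ ?_
    simp only [Function.comp_apply, Nat.cast_ofNat]
  have hev_small : ∀ᶠ x in cobounded E3, ‖G x - G₀ x‖ ≤ 16⁻¹ :=
    (htend.eventually (ge_mem_nhds (by norm_num : (0 : ℝ) < 16⁻¹)))
  -- the constant and the radius condition
  set K : ℝ := 3 * |M| + C₁ with hKdef
  have hKpos : 0 < K := by positivity
  filter_upwards [hev1, hev_small, eventually_cobounded_lt_norm (E := E3) e.R,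
    eventually_cobounded_le_norm (E := E3) (max (max 1 (4 * |M|)) (6 * K))]
    with y hy1 hysmall hyR hybig X
  have hy1' : 1 ≤ ‖y‖ := le_trans (le_trans (le_max_left _ _) (le_max_left _ _)) hybig
  have hyM : 4 * |M| ≤ ‖y‖ := le_trans (le_trans (le_max_right _ _) (le_max_left _ _)) hybig
  have hyK : 6 * K ≤ ‖y‖ := le_trans (le_max_right _ _) hybig
  have hypos : 0 < ‖y‖ := by linarith
  have hy_ne : y ≠ 0 := norm_pos_iff.1 hypos
  -- `w` between `7/8` and `9/8`
  have hw_ge : 7 / 8 ≤ w y := by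
    simp only [hwdef]
    have h1 : -|M| ≤ M := neg_abs_le M
    have h2 : M / (2 * ‖y‖) ≥ -(8⁻¹) := by
      rw [ge_iff_le, le_div_iff₀ (by positivity)]
      linarith
    linarith
  have hw_le : w y ≤ 9 / 8 := by
    simp only [hwdef]
    have h1 : M ≤ |M| := le_abs_self M
    have h2 : M / (2 * ‖y‖) ≤ 8⁻¹ := by
      rw [div_le_iff₀ (by positivity)]
      linarith
    linarith
  have hwpos : 0 < w y := by linarith
  have hw4_ge : 58 / 100 ≤ w y ^ 4 := by
    have h := pow_le_pow_left₀ (by norm_num : (0 : ℝ) ≤ 7 / 8) hw_ge 4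
    norm_num at h
    linarith
  have hw3_le : w y ^ 3 ≤ 3 / 2 := by
    have h := pow_le_pow_left₀ hwpos.le hw_le 3
    norm_num at h
    linarith
  -- differentiability at `y` and `‖DG₀‖ ≤ 3|M| r⁻²`
  have hGd : DifferentiableAt ℝ G y := (e.contDiffAt_hCoeff D hyR).differentiableAt (by simp)
  have hwd : HasFDerivAt w ((M / 2) • ((-(‖y‖ ^ 3)⁻¹) • (innerSL ℝ y : E3 →L[ℝ] ℝ))) y := by
    have h := ((hasFDerivAt_inv_norm hy_ne).const_mul (M / 2)).const_add 1
    refine h.congr_of_eventuallyEq (Filter.Eventually.of_forall fun z ↦ ?_)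
    simp only [hwdef, div_eq_mul_inv, mul_inv]
    ring
  have hw4d := hwd.pow 4
  have hDw4 : ‖fderiv ℝ (fun z : E3 ↦ w z ^ 4) y‖ ≤ 3 * |M| * (‖y‖ ^ 2)⁻¹ := by
    rw [hw4d.fderiv]
    have h0 : (4 • w y ^ (4 - 1) : ℝ) = 4 * w y ^ 3 := by norm_num [nsmul_eq_mul]
    rw [h0, norm_smul, norm_smul, norm_smul, Real.norm_eq_abs, Real.norm_eq_abs,
      Real.norm_eq_abs, abs_neg, abs_inv, abs_of_pos (pow_pos hypos 3), innerSL_apply_norm]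
    have h1 : |4 * w y ^ 3| ≤ 6 := by
      rw [abs_of_nonneg (by positivity)]
      linarith
    have h2 : |M / 2| = |M| / 2 := by rw [abs_div, abs_two]
    rw [h2]
    have h3 : (‖y‖ ^ 3)⁻¹ * ‖y‖ = (‖y‖ ^ 2)⁻¹ := by field_simp
    calc |4 * w y ^ 3| * (|M| / 2 * ((‖y‖ ^ 3)⁻¹ * ‖y‖))
        ≤ 6 * (|M| / 2 * ((‖y‖ ^ 3)⁻¹ * ‖y‖)) := by gcongr
      _ = 3 * |M| * (‖y‖ ^ 2)⁻¹ := by rw [h3]; ring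
  obtain ⟨hG₀d, hG₀n⟩ := differentiableAt_smul_const_norm_le hw4d.differentiableAt δ
  have hDG₀ : ‖fderiv ℝ G₀ y‖ ≤ 3 * |M| * (‖y‖ ^ 2)⁻¹ := by
    calc ‖fderiv ℝ G₀ y‖ ≤ ‖fderiv ℝ (fun z : E3 ↦ w z ^ 4) y‖ * ‖δ‖ := hG₀n
      _ ≤ ‖fderiv ℝ (fun z : E3 ↦ w z ^ 4) y‖ * 1 := by
          gcongr; exact norm_innerSL_bilin_le_one
      _ ≤ 3 * |M| * (‖y‖ ^ 2)⁻¹ := by rw [mul_one]; exact hDw4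
  have hsplit : fderiv ℝ (fun z ↦ G z - G₀ z) y = fderiv ℝ G y - fderiv ℝ G₀ y :=
    fderiv_fun_sub hGd hG₀d
  rw [hsplit] at hy1
  have hr32 : (‖y‖ ^ 3)⁻¹ ≤ (‖y‖ ^ 2)⁻¹ :=
    inv_anti₀ (by positivity) (pow_le_pow_right₀ hy1' (by norm_num))
  have hDG : ‖fderiv ℝ G y‖ ≤ K * (‖y‖ ^ 2)⁻¹ := by
    have h : ‖fderiv ℝ G y‖ ≤ ‖fderiv ℝ G₀ y‖ + ‖fderiv ℝ G y - fderiv ℝ G₀ y‖ := by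
      have := norm_add_le (fderiv ℝ G₀ y) (fderiv ℝ G y - fderiv ℝ G₀ y)
      rwa [add_sub_cancel] at this
    have h' : ‖fderiv ℝ G y - fderiv ℝ G₀ y‖ ≤ C₁ * (‖y‖ ^ 2)⁻¹ :=
      hy1.trans (mul_le_mul_of_nonneg_left hr32 hC₁.le)
    rw [hKdef]
    linarith
  -- coercivity and `‖♯‖ ≤ 2`
  have hcoer : ∀ v : E3, 2⁻¹ * ‖v‖ ^ 2 ≤ G y v v := fun v ↦ by
    have h1 : G y v v = G₀ y v v + (G y - G₀ y) v v := by
      simp only [_root_.sub_apply]; ring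
    have h2 : G₀ y v v = w y ^ 4 * ‖v‖ ^ 2 := by
      rw [hG₀def, smul_clm_apply₂, hδ, real_inner_self_eq_norm_sq]
    have h3 : |(G y - G₀ y) v v| ≤ 16⁻¹ * ‖v‖ ^ 2 := by
      calc |(G y - G₀ y) v v| ≤ ‖(G y - G₀ y) v‖ * ‖v‖ := by
            rw [← Real.norm_eq_abs]; exact le_opNorm _ _
        _ ≤ ‖G y - G₀ y‖ * ‖v‖ * ‖v‖ := by gcongr; exact le_opNorm _ _
        _ ≤ 16⁻¹ * ‖v‖ * ‖v‖ := by gcongr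
        _ = 16⁻¹ * ‖v‖ ^ 2 := by ring
    have h4 := neg_abs_le ((G y - G₀ y) v v)
    have h5 := mul_le_mul_of_nonneg_right hw4_ge (sq_nonneg ‖v‖)
    rw [h1, h2]
    linarith [sq_nonneg ‖v‖]
  have hinv : (G y).IsInvertible := isInvertible_of_nondegenerate fun v hv ↦ by
    have h := hcoer v
    rw [hv v] at h
    have : ‖v‖ ^ 2 ≤ 0 := by linarith
    exact norm_eq_zero.1 (pow_eq_zero_iff two_ne_zero |>.1 (le_antisymm this (sq_nonneg _)))
  have hS : ‖sharpAt G y‖ ≤ 2 := by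
    have := norm_sharpAt_le_of_coercive hinv (by norm_num : (0 : ℝ) < 2⁻¹) hcoer
    norm_num at this
    exact this
  -- the derivatives of `f = |y|²`
  set f : E3 → ℝ := fun z ↦ ‖z‖ ^ 2 with hfdef
  have hDf' : fderiv ℝ f = fun z ↦ (2 : ℝ) • ((innerSL ℝ : E3 →L[ℝ] E3 →L[ℝ] ℝ) z) := by
    funext z
    rw [show f = fun x : E3 ↦ ‖x‖ ^ 2 from rfl, fderiv_norm_sq_apply, ← Nat.cast_smul_eq_nsmul ℝ]
    norm_num
  have hDf : fderiv ℝ f y = (2 : ℝ) • (innerSL ℝ y : E3 →L[ℝ] ℝ) := by rw [hDf']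
  have hD2f : fderiv ℝ (fderiv ℝ f) y = (2 : ℝ) • (innerSL ℝ : E3 →L[ℝ] E3 →L[ℝ] ℝ) := by
    rw [hDf']
    exact (((innerSL ℝ : E3 →L[ℝ] E3 →L[ℝ] ℝ).hasFDerivAt).const_smul (2 : ℝ)).fderiv
  -- the Christoffel term
  have hΓ : |fderiv ℝ f y (chrAt G y X X)| ≤ 6 * K * ‖y‖⁻¹ * ‖X‖ ^ 2 := by
    have h1 : |fderiv ℝ f y (chrAt G y X X)| ≤ ‖fderiv ℝ f y‖ * ‖chrAt G y X X‖ := by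
      rw [← Real.norm_eq_abs]; exact le_opNorm _ _
    have h2 : ‖fderiv ℝ f y‖ ≤ 2 * ‖y‖ := by
      rw [hDf, norm_smul, Real.norm_eq_abs, abs_two, innerSL_apply_norm]
    have h3 : ‖chrAt G y X X‖ ≤ 2⁻¹ * (‖sharpAt G y‖ * (3 * ‖fderiv ℝ G y‖ * ‖X‖)) * ‖X‖ :=
      (le_opNorm _ _).trans (mul_le_mul_of_nonneg_right (norm_chrAt_apply_le X) (norm_nonneg _))
    have h4 : 2⁻¹ * (‖sharpAt G y‖ * (3 * ‖fderiv ℝ G y‖ * ‖X‖)) * ‖X‖ ≤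
        2⁻¹ * (2 * (3 * (K * (‖y‖ ^ 2)⁻¹) * ‖X‖)) * ‖X‖ := by gcongr
    have h5 : 2 * ‖y‖ * (2⁻¹ * (2 * (3 * (K * (‖y‖ ^ 2)⁻¹) * ‖X‖)) * ‖X‖) =
        6 * K * ‖y‖⁻¹ * ‖X‖ ^ 2 := by
      field_simp
      ring
    calc |fderiv ℝ f y (chrAt G y X X)| ≤ ‖fderiv ℝ f y‖ * ‖chrAt G y X X‖ := h1
      _ ≤ (2 * ‖y‖) * (2⁻¹ * (2 * (3 * (K * (‖y‖ ^ 2)⁻¹) * ‖X‖)) * ‖X‖) :=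
          mul_le_mul h2 (h3.trans h4) (norm_nonneg _) (by positivity)
      _ = 6 * K * ‖y‖⁻¹ * ‖X‖ ^ 2 := h5
  -- conclusion: `Hess = 2‖X‖² − Df(Γ(X,X)) ≥ 2‖X‖² − ‖X‖²`
  rw [hessAt_apply, hD2f]
  have hmain : ((2 : ℝ) • (innerSL ℝ : E3 →L[ℝ] E3 →L[ℝ] ℝ)) X X = 2 * ‖X‖ ^ 2 := by
    rw [smul_clm_apply₂, innerSL_apply_apply, real_inner_self_eq_norm_sq]
  rw [hmain]
  have hsmall : 6 * K * ‖y‖⁻¹ ≤ 1 := by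
    rw [mul_inv_le_iff₀ hypos]
    linarith
  have hle : |fderiv ℝ f y (chrAt G y X X)| ≤ 1 * ‖X‖ ^ 2 :=
    hΓ.trans (mul_le_mul_of_nonneg_right hsmall (sq_nonneg _))
  have := (abs_le.1 hle).2
  linarith

/-- **(2.4), radius form**: `Hess_G |y|² (X, X) ≥ ‖X‖²` for all `‖y‖ ≥ τ₁` (`τ₁ ≥ R`).
[cite: SchoenYauPMT1979, §2 Step 2, (2.4) (p. 50)] -/
theorem exists_radius_sq_le_hessAt_hCoeff_normSq {M : ℝ}
    (hAS : IsAsymptoticallySchwarzschild e D M 2) :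
    ∃ τ₁ : ℝ, e.R ≤ τ₁ ∧ ∀ y : E3, τ₁ ≤ ‖y‖ → ∀ X : E3,
      ‖X‖ ^ 2 ≤ hessAt (hCoeff e D) (fun z : E3 ↦ ‖z‖ ^ 2) y X X := by
  obtain ⟨σ₀, hσ₀⟩ := exists_radius_of_eventually (e.eventually_sq_le_hessAt_hCoeff_normSq D hAS)
  exact ⟨max σ₀ e.R, le_max_right _ _, fun y hy ↦ hσ₀ y ((le_max_left _ _).trans hy)⟩

variable [D.metric.HasLeviCivita]

omit [IsManifold (𝓡 3) ∞ X] [D.metric.HasLeviCivita] in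
/-- The function `|coord|²` is smooth at the points of the end. [folklore] -/
theorem contMDiffAt_normSq_coord {q : X} (hq : q ∈ e.U) :
    ContMDiffAt (𝓡 3) 𝓘(ℝ, ℝ) ∞ (fun p ↦ ‖e.coord p‖ ^ 2) q :=
  (contDiff_norm_sq ℝ (n := ∞)).comp_contMDiffAt (e.contMDiffAt_coord hq)

/-- **Convexity of `|x|²` on tangent vectors far out**: for `q` in the end with `‖coord q‖ ≥ τ₁`
(the radius of `exists_radius_sq_le_hessAt_hCoeff_normSq`) and a nonzero tangent vector `w`,
`Hess_h |coord|² (q)(w, w) > 0`. [cite: SchoenYauPMT1979, §2 Step 2, (2.4) (p. 50)] -/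
theorem hessian_normSq_coord_pos_of_mem {τ₁ : ℝ}
    (hest : ∀ y : E3, τ₁ ≤ ‖y‖ → ∀ X : E3,
      ‖X‖ ^ 2 ≤ hessAt (hCoeff e D) (fun z : E3 ↦ ‖z‖ ^ 2) y X X)
    {q : X} (hqU : q ∈ e.U) (hτq : τ₁ ≤ ‖e.coord q‖) {w : TangentSpace (𝓡 3) q} (hw : w ≠ 0) :
    0 < D.metric.hessian (fun p ↦ ‖e.coord p‖ ^ 2) q w w := by
  have hfar : q ∈ e.far e.R := e.mem_far_iff_coord.2 ⟨hqU, e.lt_norm_coord hqU⟩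
  obtain ⟨z, -, rfl⟩ := e.mem_far_iff.1 hfar
  obtain ⟨X₀, rfl⟩ := e.exists_mfderiv_dataChart_eq z w
  rw [e.coord_dataChart z] at hτq
  have hX₀ : X₀ ≠ 0 := by
    rintro rfl
    exact hw (map_zero _)
  have hzU : e.dataChart z ∈ e.U := (e.chart.symm z).2
  have hφ : ContMDiffAt (𝓡 3) 𝓘(ℝ, ℝ) 2 (fun p ↦ ‖e.coord p‖ ^ 2) (e.dataChart z) :=
    (e.contMDiffAt_normSq_coord hzU).of_le (WithTop.coe_le_coe.mpr le_top)
  have hrepr : ∀ y : exteriorRegion e.R,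
      (fun p ↦ ‖e.coord p‖ ^ 2) (e.dataChart y) = (fun v : E3 ↦ ‖v‖ ^ 2) y := fun y ↦ by
    simp only [e.coord_dataChart]
  have hΦr : ContDiffAt ℝ 2 (fun v : E3 ↦ ‖v‖ ^ 2) z := (contDiff_norm_sq ℝ (n := 2)).contDiffAt
  rw [e.hessian_dataChart_apply_eq_hessAt D z hφ hrepr hΦr X₀ X₀]
  have h := hest z hτq X₀
  have hX : 0 < ‖X₀‖ ^ 2 := by
    have := norm_pos_iff.2 hX₀
    positivity
  linarith

end AFEnd

namespace SchoenYau

variable {X : Type} [TopologicalSpace X] [ChartedSpace E3 X] [IsManifold (𝓡 3) ∞ X]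
  (e : AFEnd X) (D : InitialDataSet (𝓡 3) X) [D.metric.HasLeviCivita]

set_option maxHeartbeats 800000 in
/-- **Schoen–Yau 1979, (2.4): no interior maximum of `|x|²` on a minimal surface far out.** Let
`(X, h, k)` be `3`-dimensional initial data whose end `e` has the expansion (1.1)
(`IsAsymptoticallySchwarzschild e D M 2`, any `M`). There is `ρ₀ > 0` such that: for every surface
`S` (a `2`-manifold without boundary), every spacelike immersion `F : S → X` with a smooth unit
normal field and mean curvature `H ≡ 0`, and every `y₀ ∈ S` with `‖x(F y₀)‖ > ρ₀` (`x = coord`),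
the function `y ↦ ‖x(F y)‖²` does **not** have a local maximum at `y₀`. Printed: "the function
`|y|²` is a convex function for `|y| ≥ τ₁` … we may apply the maximum principle to conclude that
`S_σ ∩ N_{k'} ⊆ B_{τ₁}(0)`". Proof: `Δ_S(φ ∘ F)(y₀) = tr_S Hess_h φ(dF·, dF·)(y₀) > 0` for (a
smooth cut-off version of) `φ = |x|²` since `H = 0` (`dalembertian_comp_eq`,
`hessian_normSq_coord_pos_of_mem`), against `Δ_S ≤ 0` at a local maximum.
[cite: SchoenYauPMT1979, §2 Step 2, (2.4) (p. 50)] -/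
theorem not_isLocalMax_normSq {M : ℝ} (hAS : IsAsymptoticallySchwarzschild e D M 2) :
    ∃ ρ₀ : ℝ, 0 < ρ₀ ∧ ∀ (S : Type) [TopologicalSpace S]
      [ChartedSpace (EuclideanSpace ℝ (Fin 2)) S] [IsManifold (𝓡 2) ∞ S] (F : S → X)
      (hpb : PseudoRiemannianMetric.contMDiff_pullbackBilin (𝓡 3) X (𝓡 2) S ∞)
      (hfi : D.metric.IsSpacelikeImmersion (𝓡 2) F) (ν : NormalField (𝓡 3) F),
      ContMDiff (𝓡 2) (𝓡 3).tangent ∞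
          (fun y ↦ (TotalSpace.mk' E3 (F y) (ν y) : TangentBundle (𝓡 3) X)) →
      D.metric.IsUnitNormal (𝓡 2) F ν 1 →
      (∀ y, D.metric.meanCurvature F hpb hfi ν y = 0) →
      ∀ y₀ : S, ρ₀ < ‖e.coord (F y₀)‖ →
        ¬ IsLocalMax (fun y ↦ ‖e.coord (F y)‖ ^ 2) y₀ := by
  obtain ⟨τ₁, hτ₁, hest⟩ := e.exists_radius_sq_le_hessAt_hCoeff_normSq D hAS
  set R₁ : ℝ := e.R + 1 with hR₁
  have hR₁' : e.R < R₁ := by rw [hR₁]; linarith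
  have hRpos := e.R_pos
  refine ⟨max τ₁ (R₁ + 1), lt_max_of_lt_right (by rw [hR₁]; linarith), ?_⟩
  intro S _ _ _ F hpb hfi ν hν hun hmin y₀ hy₀ hmax
  -- the point `F y₀` lies far out in the end
  have hU : F y₀ ∈ e.U := by
    by_contra hcon
    rw [e.coord_of_not_mem hcon, norm_zero] at hy₀
    have : (0 : ℝ) < R₁ + 1 := by rw [hR₁]; linarith
    linarith [le_max_right τ₁ (R₁ + 1)]
  have hgt₁ : R₁ + 1 < ‖e.coord (F y₀)‖ := (le_max_right _ _).trans_lt hy₀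
  have hτq : τ₁ ≤ ‖e.coord (F y₀)‖ := ((le_max_left _ _).trans hy₀.le)
  have hfar : F y₀ ∈ e.far (R₁ + 1) := e.mem_far_iff_coord.2 ⟨hU, hgt₁⟩
  -- the smooth cut-off version of `|x|²`
  set φc : X → ℝ := fun p ↦ Real.smoothTransition (‖e.coord p‖ - R₁) * ‖e.coord p‖ ^ 2
    with hφcdef
  have hφc : ContMDiff (𝓡 3) 𝓘(ℝ, ℝ) ∞ φc := by
    intro q
    by_cases hq : q ∈ ((↑) : e.U → X) '' (e.chart ⁻¹' {x | R₁ ≤ ‖(x : E3)‖})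
    · obtain ⟨hqU, -⟩ := e.mem_image_preimage_le_norm_iff.1 hq
      exact ((e.contMDiff_endCutoff hR₁') q).mul (e.contMDiffAt_normSq_coord hqU)
    · refine (contMDiffAt_const (c := (0 : ℝ))).congr_of_eventuallyEq ?_
      filter_upwards [e.endCutoff_eventuallyEq_zero hR₁' hq] with p hp
      change Real.smoothTransition (‖e.coord p‖ - R₁) * ‖e.coord p‖ ^ 2 = (0 : ℝ)
      rw [hp, zero_mul]
  have hloc : φc =ᶠ[𝓝 (F y₀)] fun p ↦ ‖e.coord p‖ ^ 2 := by
    filter_upwards [e.endCutoff_eventuallyEq_one hfar] with p hp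
    change Real.smoothTransition (‖e.coord p‖ - R₁) * ‖e.coord p‖ ^ 2 = ‖e.coord p‖ ^ 2
    rw [hp, one_mul]
  -- the restrictions to the surface
  have hFs : ContMDiff (𝓡 2) (𝓡 3) ∞ F := hfi.contMDiff_self
  have hcont : Tendsto F (𝓝 y₀) (𝓝 (F y₀)) := hFs.continuous.continuousAt
  have hlocS : (fun y ↦ φc (F y)) =ᶠ[𝓝 y₀] fun y ↦ ‖e.coord (F y)‖ ^ 2 :=
    hcont.eventually hloc
  have hmaxc : IsLocalMax (fun y ↦ φc (F y)) y₀ := hlocS.isLocalMax_iff.2 hmax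
  -- (1) `Δ_S (φc ∘ F)(y₀) ≤ 0` at the local maximum
  set γ := D.metric.inducedMetric F hpb hfi with hγ
  haveI : γ.HasLeviCivita := γ.hasLeviCivita
  have hγpos : ∀ v : TangentSpace (𝓡 2) y₀, v ≠ 0 → 0 < γ.val y₀ v v := fun v hv ↦ hfi.2 y₀ v hv
  have h2le : (2 : ℕ∞ω) ≤ ∞ := WithTop.coe_le_coe.mpr le_top
  have hψc2 : ContMDiffAt (𝓡 2) 𝓘(ℝ, ℝ) 2 (fun y ↦ φc (F y)) y₀ :=
    ((hφc.comp hFs) y₀).of_le h2le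
  have hΔle : γ.dalembertian (fun y ↦ φc (F y)) y₀ ≤ 0 :=
    γ.dalembertian_nonpos_of_isLocalMax hψc2 hmaxc hγpos
  -- (2) `Δ_S (φc ∘ F)(y₀) = tr_S (Hess φc ∘ (dF × dF))` since `H = 0`
  have hdim : Module.finrank ℝ E3 = Module.finrank ℝ (EuclideanSpace ℝ (Fin 2)) + 1 := by
    rw [finrank_euclideanSpace_fin, finrank_euclideanSpace_fin]
  have hΔeq := D.metric.dalembertian_comp_eq hpb hfi hν hun one_ne_zero hdim (hφc.of_le h2le) y₀
  rw [hmin y₀, mul_zero, sub_zero] at hΔeq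
  -- (3) the tangential Hessian is positive on an orthonormal basis
  have htr : 0 < γ.trace y₀ ((D.metric.hessian φc (F y₀)).comp
      (mfderiv (𝓡 2) (𝓡 3) F y₀).toLinearMap (mfderiv (𝓡 2) (𝓡 3) F y₀).toLinearMap) := by
    obtain ⟨b, hb⟩ := γ.exists_basis_isOrthonormalFrame (x := y₀) hγpos
      (finrank_euclideanSpace_fin (𝕜 := ℝ) (n := 2))
    rw [γ.trace_eq_sum_of_isOrthonormalFrame b hb]
    refine Finset.sum_pos (fun i _ ↦ ?_) Finset.univ_nonempty
    simp only [LinearMap.BilinForm.comp_apply, ContinuousLinearMap.coe_coe]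
    rw [D.metric.hessian_congr_of_eventuallyEq hloc]
    have hw : mfderiv (𝓡 2) (𝓡 3) F y₀ (b i) ≠ 0 := by
      intro h0
      have hp := hγpos (b i) (b.ne_zero i)
      have hval : γ.val y₀ (b i) (b i) = 0 := by
        change D.metric.val (F y₀) (mfderiv (𝓡 2) (𝓡 3) F y₀ (b i))
          (mfderiv (𝓡 2) (𝓡 3) F y₀ (b i)) = 0
        rw [h0, map_zero]
      exact absurd hval hp.ne'
    exact e.hessian_normSq_coord_pos_of_mem D hest hU hτq hw
  -- (4) contradiction
  rw [hΔeq] at hΔle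
  exact absurd hΔle (not_le.2 htr)

end SchoenYau

end Literature.Geometry.Lorentzian

end
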